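import Literature.MathematicalPhysics.QuantumFieldTheory.Balaban1983to89.B1Eq324BenfattoClassSectEMemberERowsAtNode00
import Literature.MathematicalPhysics.QuantumFieldTheory.Balaban1983to89.Node00.OpsYSectEElimStar

/-!
# `Balaban1983to89.B1Eq324BenfattoClassSectEMemberERowsAtNode00Star` — THE `E`-ROWS OF THE (3.24) PRECISION DOOR AT NODE 00's STAR `C_st(V)`:
# locality radius and column mass of T. Bałaban's bond-elimination operator `C` of *Propagators for lattice gauge theories in a background field*,
# Commun. Math. Phys. **99** (1985) 389–434 [Balaban1985BackgroundPropagators], Sect. E (3.157) p. 428, in the STAR convention of [4] (2.3) ∕ Lemma 2.4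
# (def-Y STAR EDITION part 3 `Node00.OpsYSectEElimStar.elimCstY`; seat dag-n08-b g37)

statement-level companion of published sources with citation tags; every declaration here is a theorem; nothing here is a claim about the
Yang–Mills mass gap

Print, p. 428 (3.157): *«It is an identity operator on almost all bonds, except the bonds b₀ where (CB)(b₀) is equal to a solution of the equation (QB)(c) =
0»*; [5] (125) p. 36: `(Q₀A)_c = Σ_{x∈B(c₋)} L^{−(d+1)}(R_{0,c₋}A)([x, x(c)])`; [4] Lemma 2.4 p. 245: «Λ also a set of bonds b such that at least one of the end-points
b₋, b₊ belongs to Λ».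

WHY THIS FILE.  `B1Eq324BenfattoClassSectEMemberERowsAtNode00` (this lineage, gens 21–22) proved the two `E`-rows the (3.24) precision door
(`…CoReadProduct.eq324_CsDeltaCY_precision_node00_on_unit`, rows `hloc` ∕ `hmass`) reads about `C` — LOCALITY (`(C(δ_q ⊗ w))(u) ≠ 0 ⇒ |y_u − y_q| ≤ ℓ + 2`)
and COLUMN MASS (`Σ_u ‖(C(δ_q ⊗ w))(u)‖ ≤ (1 + κ_K)‖w‖`) — for def-Y's SOURCE-convention `elimCY` (constraints at BOTH-good corners `CBondY`).  The STAR
EDITION (dag-n08-b CHECK-L ∕ node00-def-Y WORD-L (a′)) indexes the constraints by the STAR corners `CBondStY` (at least one good end block) and the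
variables by `lamTstY`; `Node00.OpsYSectEElimStar.elimCstY` is the letter `C` there.  THIS FILE ports the two rows to `elimCstY` — the geometry of
[5] (125) (which unit bonds a pivot row reads, how often, how far) keys on the CORNER only, so every count transfers verbatim; the generic estimates
(`norm_trSum_le_occY_mul`, `norm_Q1Y_le_of_reads`, `norm_inverse_apply_le_of_norm_smul_sub_le`, `tdistK_upivU_src_le_of_mem_usegY`, …) are the
source file's BY NAME.

WHAT IS PROVED (member `x`, averaged-field parameter `𝔳`, star corners `c : CBondStY x`, star pivots `pivIStY`, star variables `lamTstY`):
* §1 `elimCstY_single_of_not_lamTstY` (`C_st` reads `Λ̃_st` only); ★ `sum_sum_ite_usegY_le_one_st`, ★ `sum_sum_occY_usegY_le_st` (A UNIT BOND IS READ AT MOST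
  `L` TIMES BY ALL THE STAR PIVOT ROWS TOGETHER — one start site per segment index, its block's corner determines `c`); ★ `unitDistY_pivIStY_le_of_mem_usegY`
  (a star pivot and an index bond its row reads are at `|y − y′| ≤ ℓ + 2`).
* §2 ★★ `unitDistY_le_of_elimCstY_single_ne_zero` — LOCALITY OF `C_st(V)`, radius `ℓ + 2`, EVERY background, no hypothesis.
* §3 ★★ `sum_norm_elimCstY_single_le_of_contract` — COLUMN MASS `(1 + κ_K)‖w‖` for contracting transports and a star pivot-inverse row
  `‖K_c(V)⁻¹a‖ ≤ κ_K L^{d+1}‖a‖`; `sum_norm_elimCstY_single_le` (`G`-valued `V`); ★ `inverse_KstY_one_apply` (`K_c(1)⁻¹ = L^{d+1}·id` at every star corner),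
  `norm_inverse_KstY_one_apply_le`; ★★ `sum_norm_elimCstY_single_le_one` (`U = 1`: `≤ 2‖w‖`, NO hypothesis).
* §4 THE CONSUMER's SHAPES at the seven-letter STAR record `sectELettersStYOfRecordTC x 𝔳 𝔢₀` (whose dressed `P_Λ^st C P_Λ̃` IS `C_st(V)`): ★★ `local_elimCΛstY_ofRecordTC`
  (`r := ℓ + 2`, every background), ★★ `colMass_elimCΛstY_ofRecordTC_of_contract ∕ _ofRecordTC ∕ _one` (`m := (1 + κ_K)n_e`, resp. `2n_e` at `U = 1`).
* §5 RECORD LEVEL (v7 star letters `sectEStYOfRecordV7`, fibre `M_N(ℂ)`): ★★ `local_elimC_sectEStYOfRecordV7`, ★★ `colMass_elimC_sectEStYOfRecordV7_one`.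

HONEST SCOPE.  Count-neutral Literature theorems about def-Y's star letter `C_st(V)` (lattice combinatorics of [5] (125) and norms); the small-field ∕
small-curvature pivot-inverse rows of the source file (§4 `…_of_small ∕ _of_smallVY`, §7 `…_of_plaqSmall`) are NOT ported here (they need the star twins of
`OpsYSectEElimSmall ∕ …Axial`'s `norm_KY_sub_le ∕ isUnit_KY_of_small`, def-Y successor items); `U = 1` is hypothesis-free.  Nothing of
[Balaban1985BackgroundPropagators] ∕ [Balaban1985Averaging] ∕ [Balaban1984PropagatorsII] is asserted beyond what the tree proves; node N06 ∕ N08 NOT discharged;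
nothing about the continuum, OS axioms, a mass gap or Clay.
-/

noncomputable section

open Finset

namespace Literature.MathematicalPhysics.QuantumFieldTheory.Balaban1983to89.B1Eq324BenfattoClassSectEMemberERowsAtNode00Star

open Literature.MathematicalPhysics.QuantumFieldTheory
open Literature.MathematicalPhysics.QuantumFieldTheory.Balaban1983to89.B9Eq3169Mu (hol trSum hol_cons_apply trSum_cons trSum_nil hol_nil trSum_eq_zero)
open Literature.MathematicalPhysics.QuantumFieldTheory.Balaban1983to89.B9Eq39Adjoint (R R_one)
open Literature.MathematicalPhysics.QuantumFieldTheory.Balaban1983to89.B9PinMembersKLevelV1 (MemberY)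
open Literature.MathematicalPhysics.QuantumFieldTheory.Balaban1983to89.B9PinGeometryKLevelV1 (kLab unitDistY)
open Literature.MathematicalPhysics.QuantumFieldTheory.Balaban1983to89.B6BondElimination (unitVec unitVec_apply)
open Literature.MathematicalPhysics.QuantumFieldTheory.Balaban1983to89.B6Elimination (corner mem_block)
open Literature.MathematicalPhysics.QuantumFieldTheory.Balaban1983to89.B6GlobalChartV1 (PV domT)
open Literature.MathematicalPhysics.QuantumFieldTheory.Balaban1983to89.B9Thm314GpFlatTorusGeometry (tdistK)
open Literature.MathematicalPhysics.QuantumFieldTheory.Balaban1983to89.B9Thm314QGGQInvFlatTransfer (tdistK_triangle tdistK_comm)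
open Literature.MathematicalPhysics.QuantumFieldTheory.Balaban1983to89.B9Thm314GpFlatOmegaOff (tdistK_self)
open Literature.MathematicalPhysics.QuantumFieldTheory.Balaban1983to89.Node00
open Literature.MathematicalPhysics.QuantumFieldTheory.Balaban1983to89.B1Eq324BenfattoClassSectEMemberERowsAtNode00
  (norm_trSum_le_occY_mul norm_inverse_apply_le_of_norm_smul_sub_le secY_single_of secY_single_of_not norm_readUY_single_le occY_usegY
    eq_ofZ_of_ofZ_labK_add_eq ucorner_eq_of_mem_ublockY tdistK_upivU_src_le_of_mem_usegY norm_Q1Y_le_of_reads)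

variable {d ℓ : ℕ} {hd : 1 ≤ d + 1} {hL : Odd (ℓ + 1) ∧ 1 < ℓ + 1} {w₀ w₁ : ℝ} {Mstar : ℕ}

/-! ## §1  Geometry of the readings of `Q(V)_c` at the STAR corners -/

section Readings

variable {𝔸 : Type} [NormedRing 𝔸] [NormedAlgebra ℂ 𝔸] [CompleteSpace 𝔸]
variable (x : MemberY d ℓ hd hL w₀ w₁ Mstar)

/-- **`C_st(V)` READS `Λ̃_st` ONLY**: `C_st(V)(δ_q ⊗ w) = 0` for `q ∉ Λ̃_st` (`C P_{Λ̃} = C`). [cite: Balaban1985BackgroundPropagators, (3.157) p.428, bookkeeping] -/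
theorem elimCstY_single_of_not_lamTstY (𝔳 : AvY 𝔸 x) [DecidableEq (IBondY x.toKIdx)] (U : CfgY 𝔸 x.toKIdx) {q : IBondY x.toKIdx} (hq : ¬ lamTstY x q)
    (w : 𝔸) : elimCstY x 𝔳 U (Pi.single q w) = 0 := by
  rw [← elimCstY_mul_secY, Module.End.mul_apply, secY_single_of_not hq, map_zero]

open Classical in
/-- **EACH (segment index) READS A UNIT BOND AT MOST ONCE OVER ALL (star corner, block site) PAIRS**: for fixed `s < L`, at most one pair `(c, z)`, `c` a star
corner, `z ∈ B(c₋)`, has `⟨z + s e_{μ(c)}, μ(c)⟩ = b₀` (`z = b₀₋ − s e_μ` and `c₋` is the corner of its block — corners only).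
[cite: Balaban1985Averaging, (125) p.36; Balaban1985BackgroundPropagators, p.428, bookkeeping] -/
theorem sum_sum_ite_usegY_le_one_st (b₀ : UBondY x) (s : ℕ) :
    ∑ c : CBondStY x, ∑ z ∈ ublockY x c.1.1,
      (if (⟨ofZ x (labK x z + ((s : ℕ) : ℤ) • unitVec c.1.2), c.1.2⟩ : UBondY x) = b₀ then (1 : ℝ) else 0) ≤ 1 := by
  set z₀ : USiteY x := ofZ x (labK x b₀.src - ((s : ℕ) : ℤ) • unitVec b₀.dir) with hz₀
  set c₀ : USiteY x × Fin (d + 1) := (ucorner x z₀, b₀.dir) with hc₀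
  have hterm : ∀ (c : CBondStY x) (z : USiteY x), z ∈ ublockY x c.1.1 →
      (if (⟨ofZ x (labK x z + ((s : ℕ) : ℤ) • unitVec c.1.2), c.1.2⟩ : UBondY x) = b₀ then (1 : ℝ) else 0) ≤
        if c.1 = c₀ ∧ z = z₀ then 1 else 0 := by
    intro c z hz
    by_cases h : (⟨ofZ x (labK x z + ((s : ℕ) : ℤ) • unitVec c.1.2), c.1.2⟩ : UBondY x) = b₀
    · have hμ : c.1.2 = b₀.dir := congrArg PBond.dir h
      have hsrc : ofZ x (labK x z + ((s : ℕ) : ℤ) • unitVec c.1.2) = b₀.src := congrArg PBond.src h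
      have hzz : z = z₀ := by rw [hz₀, ← hμ]; exact eq_ofZ_of_ofZ_labK_add_eq x hsrc
      have hcc : c.1 = c₀ := by
        rw [hc₀, ← hzz]
        exact Prod.ext (ucorner_eq_of_mem_ublockY x (isCoarseStY_of x c).1 hz).symm hμ
      rw [if_pos h, if_pos ⟨hcc, hzz⟩]
    · rw [if_neg h]
      split_ifs
      · exact zero_le_one
      · exact le_rfl
  have hc : ∀ c : CBondStY x, ∑ z ∈ ublockY x c.1.1, (if c.1 = c₀ ∧ z = z₀ then (1 : ℝ) else 0) ≤ if c.1 = c₀ then 1 else 0 := by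
    intro c
    by_cases hcc : c.1 = c₀
    · rw [if_pos hcc]
      calc ∑ z ∈ ublockY x c.1.1, (if c.1 = c₀ ∧ z = z₀ then (1 : ℝ) else 0)
          = ∑ z ∈ ublockY x c.1.1, (if z = z₀ then (1 : ℝ) else 0) := Finset.sum_congr rfl fun z _ => by simp only [hcc, true_and]
        _ ≤ ∑ z, (if z = z₀ then (1 : ℝ) else 0) :=
            Finset.sum_le_univ_sum_of_nonneg fun z => by positivity
        _ = 1 := by rw [Finset.sum_ite_eq' Finset.univ z₀, if_pos (Finset.mem_univ _)]
    · rw [if_neg hcc]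
      exact (Finset.sum_eq_zero fun z _ => by rw [if_neg fun h => hcc h.1]).le
  have h1 : ∑ c : CBondStY x, (if c.1 = c₀ then (1 : ℝ) else 0) ≤ 1 := by
    by_cases h0 : c₀ ∈ coarseStY x
    · have e : ∀ c : CBondStY x, (if c.1 = c₀ then (1 : ℝ) else 0) = if c = ⟨c₀, h0⟩ then 1 else 0 := by
        intro c
        by_cases hcc : c = ⟨c₀, h0⟩
        · rw [if_pos hcc, if_pos (by rw [hcc])]
        · rw [if_neg hcc, if_neg (fun h => hcc (Subtype.ext h))]
      rw [Finset.sum_congr rfl fun c _ => e c, Finset.sum_ite_eq' Finset.univ (⟨c₀, h0⟩ : CBondStY x), if_pos (Finset.mem_univ _)]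
    · refine (Finset.sum_eq_zero fun c _ => ?_).le.trans zero_le_one
      rw [if_neg]
      intro h
      exact h0 (h ▸ c.2)
  exact ((Finset.sum_le_sum fun c _ => (Finset.sum_le_sum fun z hz => hterm c z hz).trans (hc c))).trans h1

/-- ★ **A UNIT BOND IS READ AT MOST `L` TIMES BY ALL THE STAR PIVOT ROWS TOGETHER**: `Σ_{c ∈ Λ′_st} Σ_{z ∈ B(c₋)} #(b₀ ∈ [z, z(c)]) ≤ L`.
[cite: Balaban1985Averaging, (125) p.36; Balaban1985BackgroundPropagators, (3.157) p.428, bookkeeping] -/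
theorem sum_sum_occY_usegY_le_st (b₀ : UBondY x) :
    ∑ c : CBondStY x, ∑ z ∈ ublockY x c.1.1, occY b₀ (usegY x z c.1.2) ≤ ((ℓ + 1 : ℕ) : ℝ) := by
  classical
  simp_rw [occY_usegY]
  calc ∑ c : CBondStY x, ∑ z ∈ ublockY x c.1.1, ∑ s ∈ Finset.range (ℓ + 1),
          (if (⟨ofZ x (labK x z + ((s : ℕ) : ℤ) • unitVec c.1.2), c.1.2⟩ : UBondY x) = b₀ then (1 : ℝ) else 0)
      = ∑ s ∈ Finset.range (ℓ + 1), ∑ c : CBondStY x, ∑ z ∈ ublockY x c.1.1,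
          (if (⟨ofZ x (labK x z + ((s : ℕ) : ℤ) • unitVec c.1.2), c.1.2⟩ : UBondY x) = b₀ then (1 : ℝ) else 0) := by
        rw [Finset.sum_comm]
        exact Finset.sum_congr rfl fun c _ => Finset.sum_comm
    _ ≤ ∑ _s ∈ Finset.range (ℓ + 1), (1 : ℝ) := Finset.sum_le_sum fun s _ => sum_sum_ite_usegY_le_one_st x b₀ s
    _ = ((ℓ + 1 : ℕ) : ℝ) := by rw [Finset.sum_const, Finset.card_range, nsmul_eq_mul, mul_one]

omit [NormedAlgebra ℂ 𝔸] [CompleteSpace 𝔸] [NormedRing 𝔸] in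
/-- ★ **A STAR PIVOT AND AN INDEX BOND ITS ROW READS ARE AT `|y − y′| ≤ ℓ + 2`**. [cite: Balaban1985BackgroundPropagators, (3.157) p.428, (3.187) p.432, bookkeeping] -/
theorem unitDistY_pivIStY_le_of_mem_usegY (c : CBondStY x) {z : USiteY x} (hz : z ∈ ublockY x c.1.1) {b : UBondY x}
    (hb : b ∈ usegY x z c.1.2) {q : IBondY x.toKIdx} (hqb : usrc x q = b.src) : unitDistY x (pivIStY x c) q ≤ (ℓ : ℝ) + 2 := by
  have h1 := (tdistK_kLab_usrc_le x (pivIStY x c)).1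
  have h3 := (tdistK_kLab_usrc_le x q).1
  have hsrc : usrc x (pivIStY x c) = (upivU x c.1).src := by
    unfold pivIStY
    rw [usrc_idxOfU]
  have h2' := tdistK_upivU_src_le_of_mem_usegY x (isCoarseStY_of x c).1 hz hb
  have h2 : tdistK (ℓ := ℓ) (Mh := x.Mh) (k := x.k) (P := x.P') (labK x (usrc x (pivIStY x c))) (labK x (usrc x q)) ≤ ℓ := by
    rw [hsrc, hqb]
    exact h2'
  show tdistK (ℓ := ℓ) (Mh := x.Mh) (k := x.k) (P := x.P') (kLab x (pivIStY x c)) (kLab x q) ≤ _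
  calc tdistK (ℓ := ℓ) (Mh := x.Mh) (k := x.k) (P := x.P') (kLab x (pivIStY x c)) (kLab x q)
      ≤ tdistK (ℓ := ℓ) (Mh := x.Mh) (k := x.k) (P := x.P') (kLab x (pivIStY x c)) (labK x (usrc x (pivIStY x c))) +
          tdistK (ℓ := ℓ) (Mh := x.Mh) (k := x.k) (P := x.P') (labK x (usrc x (pivIStY x c))) (kLab x q) := tdistK_triangle _ _ _
    _ ≤ tdistK (ℓ := ℓ) (Mh := x.Mh) (k := x.k) (P := x.P') (kLab x (pivIStY x c)) (labK x (usrc x (pivIStY x c))) +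
          (tdistK (ℓ := ℓ) (Mh := x.Mh) (k := x.k) (P := x.P') (labK x (usrc x (pivIStY x c))) (labK x (usrc x q)) +
            tdistK (ℓ := ℓ) (Mh := x.Mh) (k := x.k) (P := x.P') (labK x (usrc x q)) (kLab x q)) :=
        add_le_add le_rfl (tdistK_triangle _ _ _)
    _ ≤ 1 + ((ℓ : ℝ) + 1) := add_le_add h1 (add_le_add h2 (by rw [tdistK_comm]; exact h3))
    _ = (ℓ : ℝ) + 2 := by ring

end Readings

/-! ## §2  LOCALITY of `C_st(V)` — every background, no hypothesis -/

section Locality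

variable {𝔸 : Type} [NormedRing 𝔸] [NormedAlgebra ℂ 𝔸] [CompleteSpace 𝔸]
variable (x : MemberY d ℓ hd hL w₀ w₁ Mstar) (𝔳 : AvY 𝔸 x)

/-- ★★ **LOCALITY OF `C_st(V)`**: `(C_st(V)(δ_q ⊗ w))(u) ≠ 0 ⟹ |y_u − y_q| ≤ ℓ + 2` on `T₁^{(k)}`, for EVERY background — `C_st` is the identity at `u = q ∈ Λ̃_st`
and otherwise nonzero only at a star pivot `u = b₀(c)` whose averaging `Q(V)_c` reads the unit bond of `q` on a segment `[z, z(c)]`, `z ∈ B(c₋)`.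
[cite: Balaban1985BackgroundPropagators, (3.157) p.428; Balaban1985Averaging, (125) p.36] -/
theorem unitDistY_le_of_elimCstY_single_ne_zero [DecidableEq (IBondY x.toKIdx)] (U : CfgY 𝔸 x.toKIdx) (q : IBondY x.toKIdx) (w : 𝔸)
    {u : IBondY x.toKIdx} (h : elimCstY x 𝔳 U (Pi.single q w) u ≠ 0) : unitDistY x u q ≤ (ℓ : ℝ) + 2 := by
  have hℓ : (0 : ℝ) ≤ (ℓ : ℝ) + 2 := by positivity
  by_cases hq : lamTstY x q
  swap
  · exact absurd (by rw [elimCstY_single_of_not_lamTstY x 𝔳 U hq, Pi.zero_apply]) h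
  rw [elimCstY_apply, secY_single_of hq] at h
  by_cases hu : u = q
  · subst hu
    show tdistK (ℓ := ℓ) (Mh := x.Mh) (k := x.k) (P := x.P') (kLab x u) (kLab x u) ≤ _
    rw [tdistK_self]
    exact hℓ
  rw [Pi.single_eq_of_ne hu, zero_sub, neg_ne_zero] at h
  obtain ⟨c, -, hc⟩ := Finset.exists_ne_zero_of_sum_ne_zero h
  by_cases huc : u = pivIStY x c
  swap
  · rw [if_neg huc] at hc
    exact absurd rfl hc
  rw [if_pos huc] at hc
  have hQ : Q1Y x 𝔳 U c.1 (Pi.single q w) ≠ 0 := fun h0 => hc (by rw [h0, map_zero])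
  rw [Q1Y_apply] at hQ
  have hS : ∑ z ∈ ublockY x c.1.1, hol (RVY x 𝔳 U) (uΓ x z) (trSum (RUY x 𝔳 U) (readUY x (Pi.single q w)) (usegY x z c.1.2)) ≠ 0 :=
    fun h0 => hQ (by rw [h0, smul_zero])
  obtain ⟨z, hz, hzne⟩ := Finset.exists_ne_zero_of_sum_ne_zero hS
  have htr : trSum (RUY x 𝔳 U) (readUY x (Pi.single q w)) (usegY x z c.1.2) ≠ 0 := fun h0 => hzne (by rw [h0, map_zero])
  obtain ⟨b, hb, hbne⟩ : ∃ b ∈ usegY x z c.1.2, readUY x (Pi.single q w) b ≠ 0 := by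
    by_contra hall
    push Not at hall
    exact htr (trSum_eq_zero _ _ hall)
  have hbq : b = ubondOfIdx x q := by
    by_contra hne
    have hle := norm_readUY_single_le x q w b
    rw [if_neg hne] at hle
    exact hbne (norm_le_zero_iff.1 hle)
  have hqb : usrc x q = b.src := by rw [hbq]; rfl
  rw [huc]
  exact unitDistY_pivIStY_le_of_mem_usegY x c hz hb hqb

end Locality

/-! ## §3  COLUMN MASS of `C_st(V)`; the star pivot-inverse row at `U = 1` -/

section ColumnMass

variable {𝔸 : Type} [NormedRing 𝔸] [NormedAlgebra ℂ 𝔸] [CompleteSpace 𝔸]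
variable (x : MemberY d ℓ hd hL w₀ w₁ Mstar) (𝔳 : AvY 𝔸 x)

/-- ★★ **COLUMN MASS OF `C_st(V)`**: for contracting unit-bond transports and a STAR pivot-inverse row `‖K_c(V)⁻¹a‖ ≤ κ_K·L^{d+1}·‖a‖` (every star corner),
`Σ_u ‖(C_st(V)(δ_q ⊗ w))(u)‖ ≤ (1 + κ_K)·‖w‖`. [cite: Balaban1985BackgroundPropagators, (3.157) p.428; Balaban1985Averaging, (125) p.36] -/
theorem sum_norm_elimCstY_single_le_of_contract [DecidableEq (IBondY x.toKIdx)] {U : CfgY 𝔸 x.toKIdx}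
    (hT : ∀ (b : UBondY x) (v : 𝔸), ‖RUY x 𝔳 U b v‖ ≤ ‖v‖) {κK : ℝ} (hκK : 0 ≤ κK)
    (hK : ∀ (c : CBondStY x) (a : 𝔸), ‖Ring.inverse (KstY x 𝔳 U c) a‖ ≤ κK * (((ℓ + 1 : ℕ) : ℝ)) ^ (d + 1) * ‖a‖)
    (q : IBondY x.toKIdx) (w : 𝔸) :
    ∑ u, ‖elimCstY x 𝔳 U (Pi.single q w) u‖ ≤ (1 + κK) * ‖w‖ := by
  by_cases hq : lamTstY x q
  swap
  · rw [elimCstY_single_of_not_lamTstY x 𝔳 U hq]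
    simp only [Pi.zero_apply, norm_zero, Finset.sum_const_zero]
    positivity
  set L : ℝ := ((ℓ + 1 : ℕ) : ℝ) with hLdef
  have hL0 : 0 < L := by rw [hLdef]; exact_mod_cast Nat.succ_pos ℓ
  have hL1 : L ≠ 0 := hL0.ne'
  set X : CBondStY x → ℝ := fun c => ‖Ring.inverse (KstY x 𝔳 U c) (Q1Y x 𝔳 U c.1 (Pi.single q w))‖ with hX
  have hpt : ∀ u, ‖elimCstY x 𝔳 U (Pi.single q w) u‖ ≤
      ‖(Pi.single q w : IBondY x.toKIdx → 𝔸) u‖ + ∑ c : CBondStY x, (if u = pivIStY x c then X c else 0) := by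
    intro u
    rw [elimCstY_apply, secY_single_of hq]
    refine (norm_sub_le _ _).trans (add_le_add le_rfl ((norm_sum_le _ _).trans (Finset.sum_le_sum fun c _ => ?_)))
    split_ifs
    · exact le_rfl
    · rw [norm_zero]
  have hsum1 : ∑ u, ‖(Pi.single q w : IBondY x.toKIdx → 𝔸) u‖ = ‖w‖ := by
    rw [Finset.sum_eq_single q (fun u _ hu => by rw [Pi.single_eq_of_ne hu, norm_zero]) (fun h => absurd (Finset.mem_univ q) h),
      Pi.single_eq_same]
  have hsum2 : ∑ u, ∑ c : CBondStY x, (if u = pivIStY x c then X c else 0) = ∑ c : CBondStY x, X c := by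
    rw [Finset.sum_comm]
    exact Finset.sum_congr rfl fun c _ => by rw [Finset.sum_ite_eq' Finset.univ (pivIStY x c), if_pos (Finset.mem_univ _)]
  have hXle : ∀ c : CBondStY x, X c ≤
      κK * L ^ (d + 1) * ((L ^ (d + 2))⁻¹ * ((∑ z ∈ ublockY x c.1.1, occY (ubondOfIdx x q) (usegY x z c.1.2)) * ‖w‖)) := by
    intro c
    refine (hK c _).trans (mul_le_mul_of_nonneg_left ?_ (by positivity))
    exact norm_Q1Y_le_of_reads x 𝔳 hT (Pi.single q w) (ubondOfIdx x q) (norm_readUY_single_le x q w) c.1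
  have hocc := sum_sum_occY_usegY_le_st x (ubondOfIdx x q)
  calc ∑ u, ‖elimCstY x 𝔳 U (Pi.single q w) u‖
      ≤ ∑ u, (‖(Pi.single q w : IBondY x.toKIdx → 𝔸) u‖ + ∑ c : CBondStY x, (if u = pivIStY x c then X c else 0)) :=
        Finset.sum_le_sum fun u _ => hpt u
    _ = ‖w‖ + ∑ c : CBondStY x, X c := by rw [Finset.sum_add_distrib, hsum1, hsum2]
    _ ≤ ‖w‖ + ∑ c : CBondStY x,
          κK * L ^ (d + 1) * ((L ^ (d + 2))⁻¹ * ((∑ z ∈ ublockY x c.1.1, occY (ubondOfIdx x q) (usegY x z c.1.2)) * ‖w‖)) :=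
        add_le_add le_rfl (Finset.sum_le_sum fun c _ => hXle c)
    _ = ‖w‖ + κK * L ^ (d + 1) * (L ^ (d + 2))⁻¹ * ‖w‖ *
          ∑ c : CBondStY x, ∑ z ∈ ublockY x c.1.1, occY (ubondOfIdx x q) (usegY x z c.1.2) := by
        rw [Finset.mul_sum]
        congr 1
        exact Finset.sum_congr rfl fun c _ => by ring
    _ ≤ ‖w‖ + κK * L ^ (d + 1) * (L ^ (d + 2))⁻¹ * ‖w‖ * L := add_le_add le_rfl (mul_le_mul_of_nonneg_left hocc (by positivity))
    _ = (1 + κK) * ‖w‖ := by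
        field_simp
        ring

/-- **COLUMN MASS, `G`-VALUED AVERAGED FIELD** (contracting `Ad V(b)`). [cite: Balaban1985BackgroundPropagators, (3.157) p.428, (3.9) p.391; Balaban1985Averaging, (125) p.36] -/
theorem sum_norm_elimCstY_single_le [DecidableEq (IBondY x.toKIdx)] {G : Subgroup 𝔸ˣ} (hG1 : ∀ g ∈ G, ‖((g : 𝔸ˣ) : 𝔸)‖ ≤ 1) {U : CfgY 𝔸 x.toKIdx}
    (h𝔳 : ∀ b, 𝔳 U b ∈ G) {κK : ℝ} (hκK : 0 ≤ κK)
    (hK : ∀ (c : CBondStY x) (a : 𝔸), ‖Ring.inverse (KstY x 𝔳 U c) a‖ ≤ κK * (((ℓ + 1 : ℕ) : ℝ)) ^ (d + 1) * ‖a‖)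
    (q : IBondY x.toKIdx) (w : 𝔸) :
    ∑ u, ‖elimCstY x 𝔳 U (Pi.single q w) u‖ ≤ (1 + κK) * ‖w‖ :=
  sum_norm_elimCstY_single_le_of_contract x 𝔳 (fun b v => by
    rw [RUY_apply]; exact B9Eq310Hermitian.norm_R_le (hG1 _ (h𝔳 b)) (hG1 _ (G.inv_mem (h𝔳 b))) v) hκK hK q w

/-- ★ **THE STAR PIVOT INVERSE AT `U = 1`**: `K_c(1)⁻¹ = L^{d+1}·id` at every star corner (part 3's `KstY_one`). [cite: Balaban1985BackgroundPropagators, p.428; Balaban1985Averaging, (125) p.36; Balaban1984PropagatorsII, (2.154) p.249] -/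
theorem inverse_KstY_one_apply (c : CBondStY x) (a : 𝔸) :
    Ring.inverse (KstY x (avYOfRecord x) (fun _ _ => 1 : CfgY 𝔸 x.toKIdx) c) a = (((ℓ + 1 : ℕ) : ℂ)) ^ (d + 1) • a := by
  have hK : IsUnit (KstY x (avYOfRecord x) (fun _ _ => 1 : CfgY 𝔸 x.toKIdx) c) := isUnit_KstY_one x c
  have h := congrArg (fun T : Module.End ℂ 𝔸 => T a) (Ring.mul_inverse_cancel _ hK)
  simp only [Module.End.mul_apply, Module.End.one_apply] at h
  rw [KstY_one] at h
  have hc : (((ℓ + 1 : ℕ) : ℂ)) ^ (d + 1) ≠ 0 := pow_ne_zero _ (Nat.cast_ne_zero.2 (Nat.succ_ne_zero ℓ))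
  calc Ring.inverse (KstY x (avYOfRecord x) (fun _ _ => 1 : CfgY 𝔸 x.toKIdx) c) a
      = (((ℓ + 1 : ℕ) : ℂ)) ^ (d + 1) •
          (((((ℓ + 1 : ℕ) : ℂ)) ^ (d + 1))⁻¹ • Ring.inverse (KstY x (avYOfRecord x) (fun _ _ => 1 : CfgY 𝔸 x.toKIdx) c) a) := by
        rw [smul_inv_smul₀ hc]
    _ = (((ℓ + 1 : ℕ) : ℂ)) ^ (d + 1) • a := by rw [h]

/-- **THE STAR PIVOT-INVERSE ROW AT `U = 1`** with `κ_K = 1`. [cite: Balaban1985BackgroundPropagators, p.428; Balaban1985Averaging, (125) p.36, bookkeeping] -/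
theorem norm_inverse_KstY_one_apply_le (c : CBondStY x) (a : 𝔸) :
    ‖Ring.inverse (KstY x (avYOfRecord x) (fun _ _ => 1 : CfgY 𝔸 x.toKIdx) c) a‖ ≤ 1 * (((ℓ + 1 : ℕ) : ℝ)) ^ (d + 1) * ‖a‖ := by
  rw [inverse_KstY_one_apply, one_mul]
  refine (norm_smul_le _ _).trans (le_of_eq ?_)
  rw [norm_pow, Complex.norm_natCast]

/-- ★★ **COLUMN MASS OF `C_st(1)` AT THE RECORD's `U = 1`: `Σ_u ‖(C_st(1)(δ_q ⊗ w))(u)‖ ≤ 2‖w‖`** — no hypothesis. [cite: Balaban1984PropagatorsII, (2.154)–(2.156) pp.249–250; Balaban1985BackgroundPropagators, (3.157) p.428] -/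
theorem sum_norm_elimCstY_single_le_one [DecidableEq (IBondY x.toKIdx)] (q : IBondY x.toKIdx) (w : 𝔸) :
    ∑ u, ‖elimCstY x (avYOfRecord x) (fun _ _ => 1 : CfgY 𝔸 x.toKIdx) (Pi.single q w) u‖ ≤ 2 * ‖w‖ :=
  (sum_norm_elimCstY_single_le_of_contract x (avYOfRecord x) (U := fun _ _ => 1)
    (fun b v => le_of_eq (by rw [RUY_apply, avYOfRecord_one, R_one])) zero_le_one (norm_inverse_KstY_one_apply_le x) q w).trans
    (by norm_num)

end ColumnMass

/-! ## §4  The consumer's shapes: rows `hloc` ∕ `hmass` at the seven-letter STAR record `𝔢 := sectELettersStYOfRecordTC x 𝔳 𝔢₀` -/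

section Door

variable {𝔸 : Type} [NormedRing 𝔸] [NormedAlgebra ℂ 𝔸] [CompleteSpace 𝔸]
variable (x : MemberY d ℓ hd hL w₀ w₁ Mstar) (𝔳 : AvY 𝔸 x)

/-- ★★ **ROW `hloc` OF THE PRECISION DOOR AT THE STAR RECORD LETTERS, `r := ℓ + 2`, EVERY BACKGROUND** (part 3: the dressed `P_Λ^st C P_Λ̃` of
`sectELettersStYOfRecordTC x 𝔳 𝔢₀` IS `C_st(V)`). [cite: Balaban1985BackgroundPropagators, (3.157) p.428, (3.187) p.432; Balaban1985UV3, (24) p.262] -/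
theorem local_elimCΛstY_ofRecordTC [DecidableEq (IBondY x.toKIdx)] (𝔢₀ : SectELettersY 𝔸 x) (U : CfgY 𝔸 x.toKIdx) {σ : Type}
    (ι : σ → IBondY x.toKIdx) :
    ∀ (s : σ) (w : 𝔸) (u : IBondY x.toKIdx), elimCΛstY x (sectELettersStYOfRecordTC x 𝔳 𝔢₀) U (Pi.single (ι s) w) u ≠ 0 →
      unitDistY x u (ι s) ≤ (ℓ : ℝ) + 2 := by
  intro s w u h
  rw [elimCΛstY_sectELettersStYOfRecordTC] at h
  exact unitDistY_le_of_elimCstY_single_ne_zero x 𝔳 U (ι s) w h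

/-- ★★ **ROW `hmass` AT THE STAR RECORD LETTERS, `m := (1 + κ_K)·n_e`**, for contracting transports, a star pivot-inverse row, and a family `b : κ → 𝔸` with
`‖b c′‖ ≤ n_e`. [cite: Balaban1985BackgroundPropagators, (3.157) p.428; Balaban1985Averaging, (125) p.36; Balaban1985UV3, (24) p.262] -/
theorem colMass_elimCΛstY_ofRecordTC_of_contract [DecidableEq (IBondY x.toKIdx)] (𝔢₀ : SectELettersY 𝔸 x) {U : CfgY 𝔸 x.toKIdx}
    (hT : ∀ (b : UBondY x) (v : 𝔸), ‖RUY x 𝔳 U b v‖ ≤ ‖v‖) {κK : ℝ} (hκK : 0 ≤ κK)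
    (hK : ∀ (c : CBondStY x) (a : 𝔸), ‖Ring.inverse (KstY x 𝔳 U c) a‖ ≤ κK * (((ℓ + 1 : ℕ) : ℝ)) ^ (d + 1) * ‖a‖)
    {κ : Type} (b : κ → 𝔸) {ne : ℝ} (hne : ∀ c', ‖b c'‖ ≤ ne) {σ : Type} (ι : σ → IBondY x.toKIdx) :
    ∀ (s : σ) (c' : κ), ∑ u, ‖elimCΛstY x (sectELettersStYOfRecordTC x 𝔳 𝔢₀) U (Pi.single (ι s) (b c')) u‖ ≤ (1 + κK) * ne := by
  intro s c'
  rw [elimCΛstY_sectELettersStYOfRecordTC]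
  exact (sum_norm_elimCstY_single_le_of_contract x 𝔳 hT hκK hK (ι s) (b c')).trans (mul_le_mul_of_nonneg_left (hne c') (by positivity))

/-- **ROW `hmass`, `G`-VALUED AVERAGED FIELD**. [cite: Balaban1985BackgroundPropagators, (3.157) p.428, (3.9) p.391; Balaban1985UV3, (24) p.262] -/
theorem colMass_elimCΛstY_ofRecordTC [DecidableEq (IBondY x.toKIdx)] (𝔢₀ : SectELettersY 𝔸 x) {G : Subgroup 𝔸ˣ}
    (hG1 : ∀ g ∈ G, ‖((g : 𝔸ˣ) : 𝔸)‖ ≤ 1) {U : CfgY 𝔸 x.toKIdx} (h𝔳 : ∀ b, 𝔳 U b ∈ G) {κK : ℝ} (hκK : 0 ≤ κK)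
    (hK : ∀ (c : CBondStY x) (a : 𝔸), ‖Ring.inverse (KstY x 𝔳 U c) a‖ ≤ κK * (((ℓ + 1 : ℕ) : ℝ)) ^ (d + 1) * ‖a‖)
    {κ : Type} (b : κ → 𝔸) {ne : ℝ} (hne : ∀ c', ‖b c'‖ ≤ ne) {σ : Type} (ι : σ → IBondY x.toKIdx) :
    ∀ (s : σ) (c' : κ), ∑ u, ‖elimCΛstY x (sectELettersStYOfRecordTC x 𝔳 𝔢₀) U (Pi.single (ι s) (b c')) u‖ ≤ (1 + κK) * ne :=
  colMass_elimCΛstY_ofRecordTC_of_contract x 𝔳 𝔢₀ (fun b v => by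
    rw [RUY_apply]; exact B9Eq310Hermitian.norm_R_le (hG1 _ (h𝔳 b)) (hG1 _ (G.inv_mem (h𝔳 b))) v) hκK hK b hne ι

/-- ★★ **ROW `hmass` AT `U = 1` OF THE STAR RECORD, NO HYPOTHESIS**: `m := 2·n_e`. [cite: Balaban1984PropagatorsII, (2.154)–(2.156) pp.249–250; Balaban1985BackgroundPropagators, (3.157) p.428; Balaban1985UV3, (24) p.262] -/
theorem colMass_elimCΛstY_ofRecordTC_one [DecidableEq (IBondY x.toKIdx)] (𝔢₀ : SectELettersY 𝔸 x) {κ : Type} (b : κ → 𝔸) {ne : ℝ}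
    (hne : ∀ c', ‖b c'‖ ≤ ne) {σ : Type} (ι : σ → IBondY x.toKIdx) :
    ∀ (s : σ) (c' : κ), ∑ u, ‖elimCΛstY x (sectELettersStYOfRecordTC x (avYOfRecord x) 𝔢₀) (fun _ _ => 1 : CfgY 𝔸 x.toKIdx)
      (Pi.single (ι s) (b c')) u‖ ≤ 2 * ne := by
  intro s c'
  have h := colMass_elimCΛstY_ofRecordTC_of_contract x (avYOfRecord x) 𝔢₀ (U := fun _ _ => 1)
    (fun b v => le_of_eq (by rw [RUY_apply, avYOfRecord_one, R_one])) zero_le_one (norm_inverse_KstY_one_apply_le x) b hne ι s c'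
  linarith

end Door

/-! ## §5  Record level: the rows at the v7 STAR Sect. E letters `sectEStYOfRecordV7` (fibre `M_N(ℂ)`) -/

section RecordV7

open scoped Matrix.Norms.L2Operator

variable (N : ℕ) (θ : Stage3Params) (M₆ : ℕ) (𝔢₀ : SectEY N θ M₆)

/-- ★★ **ROW `hloc` AT THE v7 STAR RECORD**, every background: `r := ℓ + 2`. [cite: Balaban1985BackgroundPropagators, (3.157) p.428, (3.187) p.432; Balaban1985UV3, (24) p.262] -/
theorem local_elimC_sectEStYOfRecordV7 (x : MemberY θ.d₆ θ.ℓ₆ θ.hd' θ.hL' θ.b₀ θ.b₁ M₆) [DecidableEq (IBondY x.toKIdx)]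
    (U : CfgY (Matrix (Fin N) (Fin N) ℂ) x.toKIdx) {σ : Type} (ι : σ → IBondY x.toKIdx) :
    ∀ (s : σ) (w : Matrix (Fin N) (Fin N) ℂ) (u : IBondY x.toKIdx),
      elimCΛstY x (sectEStYOfRecordV7 N θ M₆ 𝔢₀ x) U (Pi.single (ι s) w) u ≠ 0 → unitDistY x u (ι s) ≤ (θ.ℓ₆ : ℝ) + 2 :=
  local_elimCΛstY_ofRecordTC x (avYOfRecord x) (𝔢₀ x) U ι

/-- ★★ **ROW `hmass` AT THE v7 STAR RECORD, `U = 1`**: `m := 2·n_e`, no hypothesis. [cite: Balaban1984PropagatorsII, (2.154)–(2.156) pp.249–250; Balaban1985BackgroundPropagators, (3.157) p.428; Balaban1985UV3, (24) p.262] -/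
theorem colMass_elimC_sectEStYOfRecordV7_one (x : MemberY θ.d₆ θ.ℓ₆ θ.hd' θ.hL' θ.b₀ θ.b₁ M₆) [DecidableEq (IBondY x.toKIdx)] {κ : Type}
    (b : κ → Matrix (Fin N) (Fin N) ℂ) {ne : ℝ} (hne : ∀ c', ‖b c'‖ ≤ ne) {σ : Type} (ι : σ → IBondY x.toKIdx) :
    ∀ (s : σ) (c' : κ), ∑ u, ‖elimCΛstY x (sectEStYOfRecordV7 N θ M₆ 𝔢₀ x) (fun _ _ => 1 : CfgY (Matrix (Fin N) (Fin N) ℂ) x.toKIdx)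
      (Pi.single (ι s) (b c')) u‖ ≤ 2 * ne :=
  colMass_elimCΛstY_ofRecordTC_one x (𝔢₀ x) b hne ι

end RecordV7

end Literature.MathematicalPhysics.QuantumFieldTheory.Balaban1983to89.B1Eq324BenfattoClassSectEMemberERowsAtNode00Star

end
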